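import Summits.CriticalPhenomena.SAWScalingLimit.Theorems.SAWDevelopingMapInteriorFlatteningOneScaleGlue
import Summits.CriticalPhenomena.SAWScalingLimit.Theorems.SAWDevelopingMapInteriorFlatteningFactorisation
import Summits.CriticalPhenomena.SAWScalingLimit.Theorems.SAWDevelopingMapInteriorFlatteningOneMouthSimplyConnected
import Summits.CriticalPhenomena.SAWScalingLimit.Theses.SAWDevelopingMap

/-!
# The one-scale estimate: `InteriorFlattening` from the four atoms of the line `one-mouth-ball-reduction`

Lead prover `prover-line-stmt-CriticalPhenomena-8297-0`, crux stmt-CriticalPhenomena-8297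
(`…Theses.SAWDevelopingMap.InteriorFlattening`). This is the line's COMPOSITION, kernel-checked in the tree (registered
sub-goal `interiorFlattening_of_oneScale`): with the exact last-entrance factorisation (S1, `stub_factorisation`, landed)
and the simple connectivity of one-mouth sub-balls (S2, `stub_oneMouthSimplyConnected`, landed), the crux (M) follows from
the four OPEN one-scale statements (the registered stubs of the line)
  S3' windowed far-field coherence (sufficient: `PhaseConcentration η β`, `…CoherenceReduction`),
  S4  flattening of one-mouth balls (the clean core: DCS curl-vanishing without far field),
  S5' windowed re-entry arm separation (sufficient: `CoherentReentryGap ρ ∧ CleanMonopoleLowerBound κ ∧ MonopoleDecoherence κ`,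
      `κ < ρ`, `…ReentryReduction`),
  S6  `∃ d₁ K₁, DepthFlat d₁ K₁` (bounded distortion at some depth; ⇐ NoFoldBound, ⇐ (M)),
by the ONE-SCALE ESTIMATE `depthFlat_of_atoms` at an ADAPTIVE dyadic radius (`exists_window`): at depth `2R₀`,
`‖B_Λ‖ ≤ Σ_c‖amp‖‖B_c‖ ≤ (e + K₁ϑ + ϑ')·N ≤ A(e + K₁ϑ + ϑ')‖M_Λ‖`, `N = Σ_c‖amp‖‖M_c‖`. Nothing open is asserted: the atoms
are hypotheses. Sources: the line card and skeleton `Cruxes/InteriorFlattening/Lines/one-mouth-ball-reduction.{md,lean}`;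
H. Duminil-Copin, S. Smirnov, Ann. of Math. 175 (2012) for the objects.
-/

noncomputable section

open scoped BigOperators
open Literature.Probability.LatticeModels Literature.Probability.RandomPlanarGeometry.SAW

namespace Summit.CriticalPhenomena.SAWScalingLimit.Theorems.InteriorFlattening.OneMouth

/-- **One-scale estimate.** From the windowed far-field coherence, the flattening of one-mouth balls, the windowed
arm gap and bounded distortion at some depth (all as HYPOTHESES): for every `ε > 0` there is `R` with `DepthFlat R ε`. -/
theorem depthFlat_of_atoms
    (h3 : ∃ A : ℝ, 0 < A ∧ ∀ Λ : Finset HexVertex, hexDomainSimplyConnected Λ →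
    ∀ a ∈ hexDomainBoundary Λ, ∀ v ∈ Λ, ∀ r : ℝ, 1 ≤ r → Deep Λ v (2 * r) → ¬ Deep Λ v (4 * r) →
    ∀ w₀ w₁ w₂ : HexVertex, IsStar v w₀ w₁ w₂ →
      (∑ c ∈ Conf Λ (ball Λ v r), ‖amp Λ a (ball Λ v r) c‖ * ‖mono c.1 (root c) v w₀ w₁ w₂‖) ≤
        A * ‖∑ c ∈ Conf Λ (ball Λ v r), amp Λ a (ball Λ v r) c * mono c.1 (root c) v w₀ w₁ w₂‖)
    (h4 : ∀ η : ℝ, 0 < η → η ≤ 1 → ∀ e : ℝ, 0 < e → ∃ r₀ : ℝ, ∀ r : ℝ, r₀ ≤ r →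
    ∀ (D : Finset HexVertex) (u u' v : HexVertex), hexDomainSimplyConnected D →
      (∀ w ∈ D, dist (hexCenter w) (hexCenter v) ≤ r) → Deep D v (η * r) →
      hexGraph.Adj u u' → r < dist (hexCenter u) (hexCenter v) → u' ∈ D →
      ∀ w₀ w₁ w₂ : HexVertex, IsStar v w₀ w₁ w₂ →
        ‖bel D s(u, u') v w₀ w₁ w₂‖ ≤ e * ‖mono D s(u, u') v w₀ w₁ w₂‖)
    (h5 : (∀ ϑ : ℝ, 0 < ϑ → ∃ η : ℝ, 0 < η ∧ η ≤ 1 ∧ ∃ r₀ : ℝ, ∀ r : ℝ, r₀ ≤ r →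
    ∀ Λ : Finset HexVertex, hexDomainSimplyConnected Λ → ∀ a ∈ hexDomainBoundary Λ, ∀ v ∈ Λ,
      Deep Λ v (2 * r) → ¬ Deep Λ v (4 * r) → ∀ w₀ w₁ w₂ : HexVertex, IsStar v w₀ w₁ w₂ →
        (∑ c ∈ (Conf Λ (ball Λ v r)).filter (fun c => ¬ Clean (ball Λ v r) c.1 v (η * r)),
            ‖amp Λ a (ball Λ v r) c‖ * ‖mono c.1 (root c) v w₀ w₁ w₂‖) ≤
          ϑ * ∑ c ∈ Conf Λ (ball Λ v r),
            ‖amp Λ a (ball Λ v r) c‖ * ‖mono c.1 (root c) v w₀ w₁ w₂‖) ∧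
  (∀ d₀ : ℝ, 0 ≤ d₀ → ∀ ϑ : ℝ, 0 < ϑ → ∃ r₀ : ℝ, ∀ r : ℝ, r₀ ≤ r →
    ∀ Λ : Finset HexVertex, hexDomainSimplyConnected Λ → ∀ a ∈ hexDomainBoundary Λ, ∀ v ∈ Λ,
      Deep Λ v (2 * r) → ¬ Deep Λ v (4 * r) → ∀ w₀ w₁ w₂ : HexVertex, IsStar v w₀ w₁ w₂ →
        (∑ c ∈ (Conf Λ (ball Λ v r)).filter (fun c => ¬ Clean (ball Λ v r) c.1 v d₀),
            ‖amp Λ a (ball Λ v r) c‖ * pmass c.1 (root c) v w₀ w₁ w₂) ≤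
          ϑ * ∑ c ∈ Conf Λ (ball Λ v r),
            ‖amp Λ a (ball Λ v r) c‖ * ‖mono c.1 (root c) v w₀ w₁ w₂‖))
    (h6 : ∃ d₁ : ℝ, 0 ≤ d₁ ∧ ∃ K₁ : ℝ, 0 ≤ K₁ ∧ DepthFlat d₁ K₁) :
    ∀ ε : ℝ, 0 < ε → ∃ R : ℝ, DepthFlat R ε := by
  intro ε hε
  obtain ⟨A, hA, hcoh⟩ := h3
  obtain ⟨d₁, hd₁, K₁, hK₁, hqc⟩ := h6
  -- constants
  set e : ℝ := ε / (3 * A) with he_def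
  have he : 0 < e := by positivity
  set ϑB : ℝ := ε / (3 * A * (K₁ + 1)) with hϑB_def
  have hϑB : 0 < ϑB := by positivity
  obtain ⟨η, hη, hη1, r₁, h5i⟩ := h5.1 ϑB hϑB
  obtain ⟨r₂, h5ii⟩ := h5.2 d₁ hd₁ e he
  obtain ⟨r₃, h4'⟩ := h4 η hη hη1 e he
  set R₀ : ℝ := max (max (max r₁ r₂) (max r₃ d₁)) 1 with hR₀_def
  have hR₁ : r₁ ≤ R₀ := le_trans (le_trans (le_max_left _ _) (le_max_left _ _)) (le_max_left _ _)
  have hR₂ : r₂ ≤ R₀ := le_trans (le_trans (le_max_right _ _) (le_max_left _ _)) (le_max_left _ _)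
  have hR₃ : r₃ ≤ R₀ := le_trans (le_trans (le_max_left _ _) (le_max_right _ _)) (le_max_left _ _)
  have hRd : d₁ ≤ R₀ := le_trans (le_trans (le_max_right _ _) (le_max_right _ _)) (le_max_left _ _)
  have hR1 : 1 ≤ R₀ := le_max_right _ _
  refine ⟨2 * R₀, ?_⟩
  intro Λ hΛ a ha v hv hdeep₀ w₀ w₁ w₂ hstar
  -- the ADAPTIVE radius: a dyadic window `r ≥ R₀` with `B(v,2r) ⊆ Λ` but NOT `B(v,4r) ⊆ Λ`
  -- (reshape r2: far-field coherence and the arm gap are one-scale statements — the depth of `v`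
  -- must be tied to `r`, see `Lines/one-mouth-ball-reduction.md` §S3 / stub_farFieldCoherence.blocked.md)
  obtain ⟨r, hR₀r, hdeep, hwin⟩ := exists_window Λ v R₀ (lt_of_lt_of_le zero_lt_one hR1) hdeep₀
  have hr₁ : r₁ ≤ r := hR₁.trans hR₀r
  have hr₂ : r₂ ≤ r := hR₂.trans hR₀r
  have hr₃ : r₃ ≤ r := hR₃.trans hR₀r
  have hrd : d₁ ≤ r := hRd.trans hR₀r
  have hr1 : 1 ≤ r := hR1.trans hR₀r
  have hr0 : 0 ≤ r := zero_le_one.trans hr1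
  -- the specialised stub facts (before abbreviating the ball)
  have H5i := h5i r hr₁ Λ hΛ a ha v hv hdeep hwin w₀ w₁ w₂ hstar
  have H5ii := h5ii r hr₂ Λ hΛ a ha v hv hdeep hwin w₀ w₁ w₂ hstar
  have Hcoh := hcoh Λ hΛ a ha v hv r hr1 hdeep hwin w₀ w₁ w₂ hstar
  have H4 := h4' r hr₃
  set S : Finset HexVertex := ball Λ v r with hS_def
  -- basic facts about the ball `S`
  have hSΛ : S ⊆ Λ := Finset.filter_subset _ _
  have hSmem : ∀ w : HexVertex, w ∈ S ↔ dist (hexCenter w) (hexCenter v) ≤ r := by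
    intro w
    simp only [hS_def, ball, Finset.mem_filter]
    constructor
    · exact And.right
    · intro hw
      exact ⟨hdeep w (by linarith), hw⟩
  have hvS : v ∈ S := (hSmem v).2 (by rw [dist_self]; exact hr0)
  obtain ⟨hw₀, hw₁, hw₂, -, -, -⟩ := id hstar
  have hwS : ∀ w : HexVertex, hexGraph.Adj v w → w ∈ S := fun w hw =>
    (hSmem w).2 ((dist_le_one_of_adj hw).trans hr1)
  have haS : ∀ t ∈ a, t ∉ S := by
    obtain ⟨hae, u₀, v₁, rfl, hv₁, hu₀⟩ := ha
    have hadj : hexGraph.Adj u₀ v₁ := by simpa using hae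
    have hu₀far : ¬ dist (hexCenter u₀) (hexCenter v) ≤ 2 * r := fun h => hu₀ (hdeep u₀ h)
    intro t ht htS
    have htr : dist (hexCenter t) (hexCenter v) ≤ r := (hSmem t).1 htS
    rcases Sym2.mem_iff.1 ht with rfl | rfl
    · exact hu₀far (by linarith)
    · have h1 : dist (hexCenter u₀) (hexCenter t) ≤ 1 := by
        rw [dist_comm]; exact dist_le_one_of_adj hadj
      have := dist_triangle (hexCenter u₀) (hexCenter t) (hexCenter v)
      exact hu₀far (by linarith)
  -- S1: the configuration expansion of the three port values, hence of `bel` and `mono`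
  have hF : ∀ w : HexVertex, hexGraph.Adj v w →
      Fobs Λ a s(v, w) = ∑ c ∈ Conf Λ S, amp Λ a S c * Fobs c.1 (root c) s(v, w) :=
    fun w hw => stub_factorisation Λ S a v w hSΛ haS hvS (hwS w hw)
  have hbel : bel Λ a v w₀ w₁ w₂ = ∑ c ∈ Conf Λ S, amp Λ a S c * bel c.1 (root c) v w₀ w₁ w₂ := by
    simp only [bel, hF w₀ hw₀, hF w₁ hw₁, hF w₂ hw₂, Finset.mul_sum, ← Finset.sum_add_distrib]
    exact Finset.sum_congr rfl fun c _ => by ring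
  have hmono : mono Λ a v w₀ w₁ w₂ =
      ∑ c ∈ Conf Λ S, amp Λ a S c * mono c.1 (root c) v w₀ w₁ w₂ := by
    simp only [mono, hF w₀ hw₀, hF w₁ hw₁, hF w₂ hw₂, ← Finset.sum_add_distrib]
    exact Finset.sum_congr rfl fun c _ => by ring
  -- the coherent weight `N`
  obtain ⟨N, hN⟩ : ∃ N : ℝ, N = ∑ c ∈ Conf Λ S, ‖amp Λ a S c‖ * ‖mono c.1 (root c) v w₀ w₁ w₂‖ :=
    ⟨_, rfl⟩
  have hNnonneg : 0 ≤ N :=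
    hN ▸ Finset.sum_nonneg fun c _ => mul_nonneg (norm_nonneg _) (norm_nonneg _)
  rw [← hN] at H5i H5ii Hcoh
  -- per-configuration bound (three tiers)
  have hpt : ∀ c ∈ Conf Λ S,
      ‖amp Λ a S c‖ * ‖bel c.1 (root c) v w₀ w₁ w₂‖ ≤
        e * (‖amp Λ a S c‖ * ‖mono c.1 (root c) v w₀ w₁ w₂‖) +
        K₁ * (if ¬ Clean S c.1 v (η * r) then ‖amp Λ a S c‖ * ‖mono c.1 (root c) v w₀ w₁ w₂‖
          else 0) +
        (if ¬ Clean S c.1 v d₁ then ‖amp Λ a S c‖ * pmass c.1 (root c) v w₀ w₁ w₂ else 0) := by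
    rintro ⟨D, u, u'⟩ hc
    simp only [Conf, entr, Finset.mem_product, Finset.mem_powerset, Finset.mem_filter] at hc
    obtain ⟨hDS, ⟨huΛ, hu'S⟩, huS, hadj⟩ := hc
    simp only [root]
    -- nonnegativity of the three terms
    have n₁ : 0 ≤ ‖amp Λ a S (D, u, u')‖ * ‖mono D s(u, u') v w₀ w₁ w₂‖ :=
      mul_nonneg (norm_nonneg _) (norm_nonneg _)
    have hpm : 0 ≤ pmass D s(u, u') v w₀ w₁ w₂ := by
      unfold pmass zmass
      have := xc_nonneg
      positivity
    have n₂ : 0 ≤ ‖amp Λ a S (D, u, u')‖ * pmass D s(u, u') v w₀ w₁ w₂ :=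
      mul_nonneg (norm_nonneg _) hpm
    have T1 : 0 ≤ e * (‖amp Λ a S (D, u, u')‖ * ‖mono D s(u, u') v w₀ w₁ w₂‖) :=
      mul_nonneg he.le n₁
    have T2 : 0 ≤ K₁ * (if ¬ Clean S D v (η * r) then
        ‖amp Λ a S (D, u, u')‖ * ‖mono D s(u, u') v w₀ w₁ w₂‖ else 0) := by
      refine mul_nonneg hK₁ ?_
      split_ifs <;> first | exact le_rfl | exact n₁
    have T3 : 0 ≤ (if ¬ Clean S D v d₁ then
        ‖amp Λ a S (D, u, u')‖ * pmass D s(u, u') v w₀ w₁ w₂ else 0) := by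
      split_ifs <;> first | exact le_rfl | exact n₂
    -- trivial when the far amplitude vanishes
    by_cases hamp : amp Λ a S (D, u, u') = 0
    · have h0 : ‖amp Λ a S (D, u, u')‖ * ‖bel D s(u, u') v w₀ w₁ w₂‖ = 0 := by
        rw [hamp, norm_zero, zero_mul]
      rw [h0]
      exact add_nonneg (add_nonneg T1 T2) T3
    -- otherwise some outer piece realises the configuration: `D = S ∖ γ`, `u` its last vertex
    obtain ⟨γ, -, hγ⟩ := Finset.exists_ne_zero_of_sum_ne_zero hamp
    have hcond : γ.verts.getLast? = some u ∧ S \ γ.verts.toFinset = D := by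
      by_contra hno
      exact hγ (if_neg hno)
    obtain ⟨hlast, hD⟩ := hcond
    have huD : u ∉ D := fun h => huS (hDS h)
    have hsc : hexDomainSimplyConnected D := by
      rw [← hD]
      exact stub_oneMouthSimplyConnected v r S hSmem Λ a _ γ ⟨u, List.mem_of_getLast? hlast, huS⟩
    have hDr : ∀ w ∈ D, dist (hexCenter w) (hexCenter v) ≤ r := fun w hw => (hSmem w).1 (hDS hw)
    have hur : r < dist (hexCenter u) (hexCenter v) := by
      by_contra hle
      exact huS ((hSmem u).2 (not_lt.1 hle))
    -- trivial when the inner endpoint of the root was eaten by the outer piece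
    by_cases hu'D : u' ∈ D
    swap
    · have hb : bel D s(u, u') v w₀ w₁ w₂ = 0 := by
        simp only [bel, Fobs_eq_zero_of_not_mem huD hu'D, mul_zero, add_zero]
      rw [hb, norm_zero, mul_zero]
      exact add_nonneg (add_nonneg T1 T2) T3
    -- the three tiers
    by_cases hA : Clean S D v (η * r)
    · -- tier A (no crosscut within `ηr`): one-mouth ball flattening (S4)
      have hdeepD : Deep D v (η * r) := by
        intro w hw
        have hwr : dist (hexCenter w) (hexCenter v) ≤ r := by
          have : η * r ≤ 1 * r := mul_le_mul_of_nonneg_right hη1 hr0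
          linarith
        exact hA w ((hSmem w).2 hwr) hw
      have hq := H4 D u u' v hsc hDr hdeepD hadj hur hu'D w₀ w₁ w₂ hstar
      have hle : ‖amp Λ a S (D, u, u')‖ * ‖bel D s(u, u') v w₀ w₁ w₂‖ ≤
          e * (‖amp Λ a S (D, u, u')‖ * ‖mono D s(u, u') v w₀ w₁ w₂‖) :=
        calc ‖amp Λ a S (D, u, u')‖ * ‖bel D s(u, u') v w₀ w₁ w₂‖
            ≤ ‖amp Λ a S (D, u, u')‖ * (e * ‖mono D s(u, u') v w₀ w₁ w₂‖) :=
              mul_le_mul_of_nonneg_left hq (norm_nonneg _)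
          _ = e * (‖amp Λ a S (D, u, u')‖ * ‖mono D s(u, u') v w₀ w₁ w₂‖) := by ring
      linarith [T2, T3]
    · by_cases hB : Clean S D v d₁
      · -- tier B (crosscut within `ηr` but not within `d₁`): bounded distortion (S6)
        have hdeepD : Deep D v d₁ := fun w hw => hB w ((hSmem w).2 (hw.trans hrd)) hw
        have hvD : v ∈ D := hdeepD v (by rw [dist_self]; exact hd₁)
        have hbd : s(u, u') ∈ hexDomainBoundary D :=
          ⟨(SimpleGraph.mem_edgeSet _).2 hadj, u, u', rfl, hu'D, huD⟩
        have hq := hqc D hsc _ hbd v hvD hdeepD w₀ w₁ w₂ hstar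
        have hle : ‖amp Λ a S (D, u, u')‖ * ‖bel D s(u, u') v w₀ w₁ w₂‖ ≤
            K₁ * (‖amp Λ a S (D, u, u')‖ * ‖mono D s(u, u') v w₀ w₁ w₂‖) :=
          calc ‖amp Λ a S (D, u, u')‖ * ‖bel D s(u, u') v w₀ w₁ w₂‖
              ≤ ‖amp Λ a S (D, u, u')‖ * (K₁ * ‖mono D s(u, u') v w₀ w₁ w₂‖) :=
                mul_le_mul_of_nonneg_left hq (norm_nonneg _)
            _ = K₁ * (‖amp Λ a S (D, u, u')‖ * ‖mono D s(u, u') v w₀ w₁ w₂‖) := by ring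
        rw [if_pos hA]
        linarith [T1, T3]
      · -- tier C (crosscut within `d₁`): the crude mass bound
        have hle : ‖amp Λ a S (D, u, u')‖ * ‖bel D s(u, u') v w₀ w₁ w₂‖ ≤
            ‖amp Λ a S (D, u, u')‖ * pmass D s(u, u') v w₀ w₁ w₂ :=
          mul_le_mul_of_nonneg_left (norm_bel_le_pmass D s(u, u') v w₀ w₁ w₂) (norm_nonneg _)
        rw [if_pos hB]
        linarith [T1, T2]
  -- summing the per-configuration bounds
  have eq1 : (∑ c ∈ Conf Λ S,
      (e * (‖amp Λ a S c‖ * ‖mono c.1 (root c) v w₀ w₁ w₂‖) +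
        K₁ * (if ¬ Clean S c.1 v (η * r) then ‖amp Λ a S c‖ * ‖mono c.1 (root c) v w₀ w₁ w₂‖
          else 0) +
        (if ¬ Clean S c.1 v d₁ then ‖amp Λ a S c‖ * pmass c.1 (root c) v w₀ w₁ w₂ else 0))) =
      e * N +
        K₁ * (∑ c ∈ (Conf Λ S).filter (fun c => ¬ Clean S c.1 v (η * r)),
          ‖amp Λ a S c‖ * ‖mono c.1 (root c) v w₀ w₁ w₂‖) +
        ∑ c ∈ (Conf Λ S).filter (fun c => ¬ Clean S c.1 v d₁),
          ‖amp Λ a S c‖ * pmass c.1 (root c) v w₀ w₁ w₂ := by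
    rw [Finset.sum_add_distrib, Finset.sum_add_distrib, ← Finset.mul_sum, ← Finset.mul_sum,
      Finset.sum_filter, Finset.sum_filter, hN]
  have hKe : K₁ * ϑB ≤ e := by
    have h1 : K₁ / (K₁ + 1) ≤ 1 := by
      rw [div_le_one (by linarith)]
      linarith
    calc K₁ * ϑB = (K₁ / (K₁ + 1)) * e := by
          rw [hϑB_def, he_def]
          field_simp
      _ ≤ 1 * e := mul_le_mul_of_nonneg_right h1 he.le
      _ = e := one_mul e
  have hcohN : N ≤ A * ‖mono Λ a v w₀ w₁ w₂‖ := by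
    rw [hmono]
    exact Hcoh
  -- the one-scale estimate
  calc ‖bel Λ a v w₀ w₁ w₂‖
      = ‖∑ c ∈ Conf Λ S, amp Λ a S c * bel c.1 (root c) v w₀ w₁ w₂‖ := by rw [hbel]
    _ ≤ ∑ c ∈ Conf Λ S, ‖amp Λ a S c * bel c.1 (root c) v w₀ w₁ w₂‖ := norm_sum_le _ _
    _ = ∑ c ∈ Conf Λ S, ‖amp Λ a S c‖ * ‖bel c.1 (root c) v w₀ w₁ w₂‖ :=
        Finset.sum_congr rfl fun c _ => norm_mul _ _
    _ ≤ ∑ c ∈ Conf Λ S,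
          (e * (‖amp Λ a S c‖ * ‖mono c.1 (root c) v w₀ w₁ w₂‖) +
            K₁ * (if ¬ Clean S c.1 v (η * r) then
              ‖amp Λ a S c‖ * ‖mono c.1 (root c) v w₀ w₁ w₂‖ else 0) +
            (if ¬ Clean S c.1 v d₁ then ‖amp Λ a S c‖ * pmass c.1 (root c) v w₀ w₁ w₂ else 0)) :=
        Finset.sum_le_sum hpt
    _ = e * N +
          K₁ * (∑ c ∈ (Conf Λ S).filter (fun c => ¬ Clean S c.1 v (η * r)),
            ‖amp Λ a S c‖ * ‖mono c.1 (root c) v w₀ w₁ w₂‖) +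
          ∑ c ∈ (Conf Λ S).filter (fun c => ¬ Clean S c.1 v d₁),
            ‖amp Λ a S c‖ * pmass c.1 (root c) v w₀ w₁ w₂ := eq1
    _ ≤ e * N + K₁ * (ϑB * N) + e * N := by gcongr
    _ = (e + K₁ * ϑB + e) * N := by ring
    _ ≤ (e + e + e) * N := by gcongr
    _ = (ε / A) * N := by rw [he_def]; ring
    _ ≤ (ε / A) * (A * ‖mono Λ a v w₀ w₁ w₂‖) := by gcongr
    _ = ε * ‖mono Λ a v w₀ w₁ w₂‖ := by field_simp


/-- **`InteriorFlattening` from the four one-scale statements** (registered sub-goal; the line's composition in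
the tree): windowed far-field coherence S3' → flattening of one-mouth balls S4 → windowed re-entry arm separation S5' →
bounded distortion at some depth S6 → (M). S1 and S2 are landed theorems used inside; the sufficient conditions
`PhaseConcentration ⇒ S3'` and `E1+E2+E3 ⇒ S5'` are landed separately (`…CoherenceReduction`, `…ReentryReduction`). -/
theorem interiorFlattening_of_oneScale :
    (∃ A : ℝ, 0 < A ∧ ∀ Λ : Finset HexVertex, hexDomainSimplyConnected Λ →
    ∀ a ∈ hexDomainBoundary Λ, ∀ v ∈ Λ, ∀ r : ℝ, 1 ≤ r → Deep Λ v (2 * r) → ¬ Deep Λ v (4 * r) →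
    ∀ w₀ w₁ w₂ : HexVertex, IsStar v w₀ w₁ w₂ →
      (∑ c ∈ Conf Λ (ball Λ v r), ‖amp Λ a (ball Λ v r) c‖ * ‖mono c.1 (root c) v w₀ w₁ w₂‖) ≤
        A * ‖∑ c ∈ Conf Λ (ball Λ v r), amp Λ a (ball Λ v r) c * mono c.1 (root c) v w₀ w₁ w₂‖) →
    (∀ η : ℝ, 0 < η → η ≤ 1 → ∀ e : ℝ, 0 < e → ∃ r₀ : ℝ, ∀ r : ℝ, r₀ ≤ r →
    ∀ (D : Finset HexVertex) (u u' v : HexVertex), hexDomainSimplyConnected D →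
      (∀ w ∈ D, dist (hexCenter w) (hexCenter v) ≤ r) → Deep D v (η * r) →
      hexGraph.Adj u u' → r < dist (hexCenter u) (hexCenter v) → u' ∈ D →
      ∀ w₀ w₁ w₂ : HexVertex, IsStar v w₀ w₁ w₂ →
        ‖bel D s(u, u') v w₀ w₁ w₂‖ ≤ e * ‖mono D s(u, u') v w₀ w₁ w₂‖) →
    ((∀ ϑ : ℝ, 0 < ϑ → ∃ η : ℝ, 0 < η ∧ η ≤ 1 ∧ ∃ r₀ : ℝ, ∀ r : ℝ, r₀ ≤ r →
    ∀ Λ : Finset HexVertex, hexDomainSimplyConnected Λ → ∀ a ∈ hexDomainBoundary Λ, ∀ v ∈ Λ,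
      Deep Λ v (2 * r) → ¬ Deep Λ v (4 * r) → ∀ w₀ w₁ w₂ : HexVertex, IsStar v w₀ w₁ w₂ →
        (∑ c ∈ (Conf Λ (ball Λ v r)).filter (fun c => ¬ Clean (ball Λ v r) c.1 v (η * r)),
            ‖amp Λ a (ball Λ v r) c‖ * ‖mono c.1 (root c) v w₀ w₁ w₂‖) ≤
          ϑ * ∑ c ∈ Conf Λ (ball Λ v r),
            ‖amp Λ a (ball Λ v r) c‖ * ‖mono c.1 (root c) v w₀ w₁ w₂‖) ∧
  (∀ d₀ : ℝ, 0 ≤ d₀ → ∀ ϑ : ℝ, 0 < ϑ → ∃ r₀ : ℝ, ∀ r : ℝ, r₀ ≤ r →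
    ∀ Λ : Finset HexVertex, hexDomainSimplyConnected Λ → ∀ a ∈ hexDomainBoundary Λ, ∀ v ∈ Λ,
      Deep Λ v (2 * r) → ¬ Deep Λ v (4 * r) → ∀ w₀ w₁ w₂ : HexVertex, IsStar v w₀ w₁ w₂ →
        (∑ c ∈ (Conf Λ (ball Λ v r)).filter (fun c => ¬ Clean (ball Λ v r) c.1 v d₀),
            ‖amp Λ a (ball Λ v r) c‖ * pmass c.1 (root c) v w₀ w₁ w₂) ≤
          ϑ * ∑ c ∈ Conf Λ (ball Λ v r),
            ‖amp Λ a (ball Λ v r) c‖ * ‖mono c.1 (root c) v w₀ w₁ w₂‖)) →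
    (∃ d₁ : ℝ, 0 ≤ d₁ ∧ ∃ K₁ : ℝ, 0 ≤ K₁ ∧ DepthFlat d₁ K₁) →
    Summit.CriticalPhenomena.SAWScalingLimit.Theses.SAWDevelopingMap.InteriorFlattening := by
  intro h3 h4 h5 h6
  have key : ∀ ε : ℝ, 0 < ε → ∃ R : ℝ, DepthFlat R ε := depthFlat_of_atoms h3 h4 h5 h6
  intro ε hε
  obtain ⟨R, hR⟩ := key ε hε
  refine ⟨R, ?_⟩
  intro Λ hΛ a ha v hv hb w₀ w₁ w₂ h₀ h₁ h₂ n₁ n₂ n₃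
  exact hR Λ hΛ a ha v hv hb w₀ w₁ w₂ ⟨h₀, h₁, h₂, n₁, n₂, n₃⟩

end Summit.CriticalPhenomena.SAWScalingLimit.Theorems.InteriorFlattening.OneMouth

end
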